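import Summits.CriticalPhenomena.PercolationContinuityZ3.Theorems.PercNearOneGluingNoHeavyLowerTailSahiCTCRtForm
import Summits.CriticalPhenomena.PercolationContinuityZ3.Theorems.PercNearOneGluingNoHeavyLowerTailSahiCTCLumpedForms
import HarnessLib

/-!
# `NoHeavyLowerTail` (crux stmt-CriticalPhenomena-4575), P3 lane: the level-`t` forms ARE the lumped forms of `D = {S : #S < t}` —
# so the one-vertex-monotonicity reduction applies to `R_t` verbatim

Support file (seat `prim-l12-p3`, gen 28; `--supports stmt-CriticalPhenomena-4575`).  Bridge between `…SahiCTCRtForm` (`Rt`, `Nt`) and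
`…SahiCTCLumpedForms` (`Rlump`, `Nlump`, `coeff_Rlump_nonneg_of_C1_C2`): `Rt_eq_Rlump`, `Nt_eq_Nlump`, and **`coeff_Rt_nonneg_of_C1_C2`** — memo g27 §4.1:
the conjectured one-vertex monotonicities C1/C2 of the coefficients of `R_t(𝒳,𝒵)` imply `R_t(𝒳,𝒵) ∈ ℕ[s]`.  Nothing is asserted about the crux.
-/

noncomputable section

open scoped Classical

namespace Summit.CriticalPhenomena.PercolationContinuityZ3.Theorems.SahiCTCForms

open Finset MvPolynomial SahiCTCGenFun

variable {α : Type*} [DecidableEq α] [Fintype α]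

/-- `R_t = R_D` for the lumped family `D = {S : #S < t}`. [this work] -/
theorem Rt_eq_Rlump (t : ℕ) (F G : Finset (Finset α)) : Rt t F G = Rlump (bySize (· < t)) F G := by
  unfold bySize
  rw [Rlump_threshold_eq]
  rfl

/-- `N_t = N_D` for the lumped family `D = {S : #S < t}`. [this work] -/
theorem Nt_eq_Nlump (t : ℕ) (F G : Finset (Finset α)) : Nt t F G = Nlump (bySize (· < t)) F G := by
  have h : ∀ K : Finset (Finset α), (K.filter fun S => S ∈ (bySize (· < t) : Finset (Finset α))) = K.filter fun S => #S < t :=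
    fun K => filter_congr fun S _ => by simp only [bySize, mem_filter, mem_powerset, subset_univ, true_and]
  unfold Nt Nlump below
  rw [h, h, h]

/-- **C1 ∧ C2 ⇒ `R_t ∈ ℕ[s]`** (memo g27 §4.1, for the level-`t` R form of any pair). [this work] -/
theorem coeff_Rt_nonneg_of_C1_C2 (t : ℕ) (F G : Finset (Finset α))
    (hC1 : ∀ (m : α →₀ ℕ) (v : α), m v = 1 → (Rt t F G).coeff (m - Finsupp.single v 1) ≤ (Rt t F G).coeff m)
    (hC2 : ∀ (m : α →₀ ℕ) (v : α), m v = 2 → (Rt t F G).coeff (m + Finsupp.single v 1) ≤ (Rt t F G).coeff m) (m : α →₀ ℕ) :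
    0 ≤ (Rt t F G).coeff m := by
  rw [Rt_eq_Rlump] at hC1 hC2 ⊢
  exact coeff_Rlump_nonneg_of_C1_C2 _ F G hC1 hC2 m

end Summit.CriticalPhenomena.PercolationContinuityZ3.Theorems.SahiCTCForms
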